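import Literature.NumberTheory.Transcendental.SemialgebraicGrounding
import Literature.NumberTheory.Transcendental.KZSemiCanonicalReductionDimOne
import Summits.KontsevichZagierPeriods.KontsevichZagierPeriods.Theorems.HurwitzMicroSectorsNormalFormPrincipleBoxRigidityDimOne

/-!
# `NormalFormPrinciple` (stmt-KontsevichZagierPeriods-3869), line `SketchIdeator1` —
# the leaf off the box in dimension one, II: algebraic break points of a semialgebraic subset of the line

Pure proof file (lead seat c4; `--supports` the crux). The o-minimal "finite boundary" property of a
`ℚ`-semialgebraic subset `σ` of `ℝ¹`, with the arithmetic information the moves need: there is a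
finite set `F` of REAL ALGEBRAIC numbers such that every open interval containing no point of `F`
lies inside `σ` or is disjoint from it (`exists_algebraic_breakpoints`). Proof: present `σ` by a sign
condition on finitely many polynomials `q ∈ ℚ[x₀]` (`IsSemialgebraic.exists_eq_setOf_signVec_mem`);
`F` is the set of real roots of the nonzero ones; off `F` every sign is locally constant
(continuity), hence so is membership in `σ`, and an interval is connected
(`FibreLength.subset_or_disjoint_of_isPreconnected`).

Sources: L. van den Dries, *Tame topology and o-minimal structures* (1998), Ch. 1 (3.3)(ii), Ch. 2
(3.3); J. Bochnak, M. Coste, M.-F. Roy, *Real Algebraic Geometry* (1998), §2.3. No definitions are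
introduced.
-/

noncomputable section

open MeasureTheory Set Finset Filter Topology
open scoped Polynomial
open Literature.NumberTheory.Transcendental Literature.NumberTheory.Transcendental.KZ
open Literature.ModelTheory.ExponentialFields (IsSemialgebraic isSemialgebraic_univ)

namespace Summit.KontsevichZagierPeriods.HurwitzMicroSectors.NormalFormPrinciple.PiBox

namespace Dlog

/-! ## Signs of one-variable rational polynomials are locally constant off their roots -/

/-- **Local constancy of the sign.** Let `q ∈ ℚ[x₀]` and let `u ∈ ℝ` be no real root of the
one-variable reading `q₁` of `q` unless `q₁ = 0`. Then `sign (q (t))` is constant for `t` near `u`.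
[cite: BochnakCosteRoy1998, §2.3] -/
theorem eventually_sign_aeval_eq (q : MvPolynomial (Fin 1) ℚ) {u : ℝ}
    (hu : MvPolynomial.aeval (fun _ : Fin 1 => (Polynomial.X : ℚ[X])) q ≠ 0 →
      (Polynomial.aeval u (MvPolynomial.aeval (fun _ : Fin 1 => (Polynomial.X : ℚ[X])) q) : ℝ) ≠ 0) :
    ∀ᶠ u' in 𝓝 u, SignType.sign (MvPolynomial.aeval (fun _ : Fin 1 => u') q : ℝ) =
      SignType.sign (MvPolynomial.aeval (fun _ : Fin 1 => u) q : ℝ) := by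
  set q₁ : ℚ[X] := MvPolynomial.aeval (fun _ : Fin 1 => (Polynomial.X : ℚ[X])) q with hq₁
  have hread : ∀ t : ℝ, (MvPolynomial.aeval (fun _ : Fin 1 => t) q : ℝ) = Polynomial.aeval t q₁ :=
    fun t => (aeval_fin_one_eq q (fun _ => t)).symm
  simp_rw [hread]
  by_cases hq0 : q₁ = 0
  · simp [hq0]
  have hu0 : (Polynomial.aeval u q₁ : ℝ) ≠ 0 := hu hq0
  have hcont : ContinuousAt (fun t : ℝ => (Polynomial.aeval t q₁ : ℝ)) u :=
    (Polynomial.continuous_aeval q₁).continuousAt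
  rcases lt_trichotomy (Polynomial.aeval u q₁ : ℝ) 0 with hlt | heq | hgt
  · filter_upwards [hcont.eventually (gt_mem_nhds hlt)] with u' hu'
    rw [sign_neg hu', sign_neg hlt]
  · exact (hu0 heq).elim
  · filter_upwards [hcont.eventually (lt_mem_nhds hgt)] with u' hu'
    rw [sign_pos hu', sign_pos hgt]

/-! ## Algebraic break points -/

/-- **Finite boundary with algebraic break points** (o-minimality of the real field on the line,
arithmetic form). A `ℚ`-semialgebraic `σ ⊆ ℝ¹` admits a finite set `F` of real ALGEBRAIC numbers such
that every open coordinate slab `{x | p < x₀ < q}` whose interval `(p, q)` contains no point of `F` is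
contained in `σ` or disjoint from `σ` (`F` = the real roots of the nonzero polynomials of a sign
presentation of `σ`). [cite: Dries1998, Ch. 1 (3.3)(ii) and Ch. 2 (3.3)] -/
theorem exists_algebraic_breakpoints {σ : Set (Fin 1 → ℝ)} (hσ : IsSemialgebraic ℚ σ) :
    ∃ F : Finset ℝ, (∀ z ∈ F, IsAlgebraic ℚ z) ∧
      ∀ p q : ℝ, (∀ z ∈ F, z ∉ Set.Ioo p q) →
        {x : Fin 1 → ℝ | x 0 ∈ Set.Ioo p q} ⊆ σ ∨ Disjoint {x : Fin 1 → ℝ | x 0 ∈ Set.Ioo p q} σ := by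
  classical
  obtain ⟨Q, T, rfl⟩ := hσ.exists_eq_setOf_signVec_mem
  -- one-variable readings and their real roots
  set rd : MvPolynomial (Fin 1) ℚ → ℚ[X] := fun q =>
    MvPolynomial.aeval (fun _ : Fin 1 => (Polynomial.X : ℚ[X])) q with hrd
  set F : Finset ℝ := Q.biUnion fun q => ((rd q).map (algebraMap ℚ ℝ)).roots.toFinset with hF
  have hmapeval : ∀ q (t : ℝ), ((rd q).map (algebraMap ℚ ℝ)).eval t = Polynomial.aeval t (rd q) :=
    fun q t => by rw [Polynomial.eval_map, ← Polynomial.aeval_def]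
  refine ⟨F, fun z hz => ?_, fun p q hpq => ?_⟩
  · -- the break points are algebraic
    rw [hF, Finset.mem_biUnion] at hz
    obtain ⟨q, -, hzq⟩ := hz
    rw [Multiset.mem_toFinset, Polynomial.mem_roots', Polynomial.IsRoot.def, hmapeval] at hzq
    refine ⟨rd q, fun h => hzq.1 ?_, hzq.2⟩
    rw [h, Polynomial.map_zero]
  · -- membership is locally constant off `F`
    set A : Set ℝ := {t | (fun _ : Fin 1 => t) ∈
      {x : Fin 1 → ℝ | (fun q : Q => SignType.sign (MvPolynomial.aeval x (q : MvPolynomial (Fin 1) ℚ))) ∈ T}}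
      with hA
    have hloc : ∀ u ∈ Set.Ioo p q, ∀ᶠ u' in 𝓝 u, u' ∈ A ↔ u ∈ A := by
      intro u hu
      have huF : u ∉ F := fun h => hpq u h hu
      have hsign : ∀ q' ∈ Q, ∀ᶠ u' in 𝓝 u,
          SignType.sign (MvPolynomial.aeval (fun _ : Fin 1 => u') q' : ℝ) =
            SignType.sign (MvPolynomial.aeval (fun _ : Fin 1 => u) q' : ℝ) := by
        intro q' hq'
        refine eventually_sign_aeval_eq q' fun hne h0 => huF ?_
        rw [hF, Finset.mem_biUnion]
        refine ⟨q', hq', ?_⟩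
        rw [Multiset.mem_toFinset, Polynomial.mem_roots', Polynomial.IsRoot.def, hmapeval]
        refine ⟨fun h => hne ?_, h0⟩
        exact (Polynomial.map_eq_zero_iff (algebraMap ℚ ℝ).injective).mp h
      filter_upwards [(Q.eventually_all).2 hsign] with u' hu'
      have e : (fun q' : Q => SignType.sign (MvPolynomial.aeval (fun _ : Fin 1 => u')
          (q' : MvPolynomial (Fin 1) ℚ) : ℝ)) =
          fun q' : Q => SignType.sign (MvPolynomial.aeval (fun _ : Fin 1 => u)
            (q' : MvPolynomial (Fin 1) ℚ) : ℝ) := funext fun q' => hu' q' q'.2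
      show (fun q' : Q => SignType.sign (MvPolynomial.aeval (fun _ : Fin 1 => u')
          (q' : MvPolynomial (Fin 1) ℚ) : ℝ)) ∈ T ↔
        (fun q' : Q => SignType.sign (MvPolynomial.aeval (fun _ : Fin 1 => u)
          (q' : MvPolynomial (Fin 1) ℚ) : ℝ)) ∈ T
      rw [e]
    rcases FibreLength.subset_or_disjoint_of_isPreconnected isPreconnected_Ioo hloc with h | h
    · refine Or.inl fun x hx => ?_
      have := h hx
      rw [hA, Set.mem_setOf_eq, ← eq_const_apply_zero x] at this
      exact this
    · refine Or.inr (Set.disjoint_left.2 fun x hx hxσ => ?_)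
      refine Set.disjoint_left.1 h hx ?_
      rw [hA, Set.mem_setOf_eq, ← eq_const_apply_zero x]
      exact hxσ

end Dlog

end Summit.KontsevichZagierPeriods.HurwitzMicroSectors.NormalFormPrinciple.PiBox
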